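import Literature.Computability.Complexity.GateEliminationClosed
import Literature.Computability.Complexity.GateEliminationNormalize

/-!
# Gate elimination: the standing assumptions of Li–Yang's case analysis from Case 5 on

The notions in which the proof of Theorem 4.1 (ECCC TR21-023, §4.1) states what Cases 0–4 have
achieved when Case 5 begins:

* `Semicircuit.Useless` (§3.3, Rule 4: "a gate is called useless if it is a `1`-gate with only
  descendant `Q`, such that another input of `Q` also feeds `G`") and `Semicircuit.Normalized`
  (§3.3: "a circuit is called normalized if no normalization rule can apply to it"; Case 0.1) —
  `PreNormalized` (Rules 1, 2/3, 5) and no useless gate;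
* `Semicircuit.ReachesOut` (Case 0.2: "the output gate is not reachable from it" excluded for
  gates of the acyclic part) — a theorem for pre-normalized circuits, `reachesOut_of_preNormalized`;
* `Semicircuit.DepOnlyOn`, `Semicircuit.NonDegenerate` (Case 0.3: no "gate `G` outputing a fixed
  constant `c` for any assignment to the variables", no "gate `G` fed by `I₁` and `I₂` that
  computes a function that only depends on `I₁`": "from now on … the output of each gate depends
  on both of its inputs"); `NonDegenerate` is a predicate — a standing HYPOTHESIS achieved by
  simplification (Case 0.3 is dispatched in `GateEliminationAssembly.lean`), not a claim:
  `Semicircuit.exists_normalized_not_nonDegenerate` is a fair normalized circuit of ∧-type gates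
  with a constant gate;
* `Semicircuit.Standing` — all standing assumptions after Case 4: normalized, reachability,
  non-degeneracy, no troubled pair (Case 0.4 via Lemma 3.12 makes the packing empty), and the
  negations of the hypotheses of Cases 1–4.

Also: the output of a fair semicircuit computing an affine disperser is not in the xor-part
(`out_ne_gate_of_mem_xorPart`: it would compute an affine function).

## References

* J. Li, T. Yang, *3.1n − o(n) circuit lower bounds for explicit functions*, STOC 2022;
  ECCC TR21-023, §3.3 (Rule 4, normalized circuits), §4.1 (Cases 0.2, 0.3, 0.4, 1–4).
-/

namespace Literature.Computability.Complexity

open Finset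

namespace Semicircuit

variable {n : ℕ} (C : Semicircuit n)

/-! ### Useless gates, normalized circuits -/

/-- Gate `G` is **useless** (Li–Yang §3.3, Rule 4): a `1`-gate whose only reader `Q ≠ G` reads, at
its other position, a node that `G` reads too ("another input of `Q` also feeds `G`").
[cite: LiYang2022, §3.3 (Rule 4)] -/
def Useless (G : Fin C.m) : Prop :=
  C.fanout (.gate G) = 1 ∧ ∃ (Q : Fin C.m) (aQ aG : Fin 2), G ≠ Q ∧ C.arg Q aQ = .gate G ∧ C.arg Q aQ.rev = C.arg G aG

/-- A circuit is **normalized** (Li–Yang §3.3: "a circuit is called normalized if no normalization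
rule can apply to it"): pre-normalized (Rules 1, 2/3, 5: the only `0`-gate is the output, no gate
reads a constant, no coinciding wires) and without useless gates (Rule 4). A PREDICATE on
semicircuits (the circuit is an explicit parameter), not a claim about all circuits; its
theorem-content (Lemma 3.11, Case 0.1: for `0 ≤ α_φ ≤ 1/2`, `0 ≤ α_I`, a fair semicircuit
computing `f|_R`, `dim R ≥ 2d + 2`, with a packing has a normalized fair replacement with no more
gates and no larger measure) is `Semicircuit.exists_normalized` in
`GateEliminationStandingProofs.lean`. [cite: LiYang2022, §3.3] -/
def Normalized (C : Semicircuit n) : Prop :=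
  C.PreNormalized ∧ ∀ G, ¬ C.Useless G

/-! ### Reachability of the output (Case 0.2) -/

/-- Gate `k'` reads gate `k`. [folklore] -/
def Reads (k k' : Fin C.m) : Prop := ∃ a, C.arg k' a = .gate k

/-- **The output is reachable from gate `G`**: the output is a gate at the end of a (possibly
empty) path of wires from `G`. [cite: LiYang2022, §4.1 (Case 0.2)] -/
def ReachesOut (G : Fin C.m) : Prop :=
  ∃ k, C.out = .gate k ∧ Relation.ReflTransGen C.Reads G k

/-- **Case 0.2 for pre-normalized circuits**: the output is reachable from every gate of the
acyclic part (a gate of maximal rank among those reachable from `G` has no reader, so it is the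
unique `0`-gate, the output). [cite: LiYang2022, §4.1 (Case 0.2)] -/
theorem reachesOut_of_preNormalized (hN : C.PreNormalized) {G : Fin C.m} (hG : G ∉ C.xorPart) : C.ReachesOut G := by
  classical
  obtain ⟨ρ, hρ⟩ := C.acyclic
  -- gates of the acyclic part reachable from `G`
  let U : Finset (Fin C.m) := univ.filter fun k => k ∉ C.xorPart ∧ Relation.ReflTransGen C.Reads G k
  have hGU : G ∈ U := mem_filter.mpr ⟨mem_univ _, hG, Relation.ReflTransGen.refl⟩
  obtain ⟨k, hkU, hkmax⟩ := exists_max_image U ρ ⟨G, hGU⟩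
  obtain ⟨-, hkK, hGk⟩ := mem_filter.mp hkU
  refine ⟨k, hN.out_of_fanout_eq_zero k ?_, hGk⟩
  rw [fanout_eq_zero_iff]
  intro k' a h
  have hk'K : k' ∉ C.xorPart := fun hk' => hkK (C.mem_of_arg_eq k' hk' a k h)
  have hlt : ρ k < ρ k' := hρ k' hk'K a k h hkK
  have hk'U : k' ∈ U := mem_filter.mpr ⟨mem_univ _, hk'K, hGk.tail ⟨a, h⟩⟩
  have := hkmax k' hk'U
  omega

/-! ### Non-degeneracy (Case 0.3) -/

/-- Gate `k` **depends only on its wire at position `a`**: on every solution its value is a function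
of the value of that wire ("a gate … that computes a function that only depends on `I₁`"; a gate
"outputing a fixed constant" is the case of a constant function). [cite: LiYang2022, §4.1 (Case 0.3)] -/
def DepOnlyOn (k : Fin C.m) (a : Fin 2) : Prop :=
  ∃ h : Bool → Bool, ∀ (x : Fin n → Bool) (w : Fin C.m → Bool), C.Consistent x w → w k = h (C.nodeVal x w (C.arg k a))

/-- The circuit is **non-degenerate**: no gate computes a constant and every gate depends on both
of its inputs (Li–Yang Case 0.3: "from now on, … the output of each gate depends on both of its
inputs"). A PREDICATE on semicircuits — the standing hypothesis `Standing.nonDegenerate`, which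
gate elimination *achieves* by removing a degenerate gate (Case 0.3, `simplify_of_depOnlyOn` in
`GateEliminationAssembly.lean`) — not a claim about all circuits:
`exists_normalized_not_nonDegenerate` below is a fair normalized circuit that is degenerate.
[cite: LiYang2022, §4.1 (Case 0.3)] -/
def NonDegenerate (C : Semicircuit n) : Prop := ∀ (k : Fin C.m) (a : Fin 2), ¬ C.DepOnlyOn k a

/-- A gate computing a constant depends only on (either of) its wires. [folklore] -/
theorem depOnlyOn_of_const {k : Fin C.m} {b : Bool}
    (h : ∀ (x : Fin n → Bool) (w : Fin C.m → Bool), C.Consistent x w → w k = b) (a : Fin 2) : C.DepOnlyOn k a :=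
  ⟨fun _ => b, fun x w hw => h x w hw⟩

/-- **Non-degeneracy is a genuine, semantic hypothesis — not a consequence of normalization.**
`NonDegenerate` is a PREDICATE on semicircuits: the standing assumption of Li–Yang's Case 0.3
(`Standing.nonDegenerate`), *achieved* during gate elimination by removing a degenerate gate
(`simplify_of_depOnlyOn` in `GateEliminationAssembly.lean`), not a claim about all circuits.
Indeed the circuit `G₀ = x₀ ∧ x₁`, `G₁ = ¬x₀ ∧ x₂`, `G₂ = G₀ ∧ G₁` (output) is fair, normalized
(none of Rules 1–5 applies) and all its gates are ∧-type, yet `G₂` computes the constant `0`: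
Case 0.3 is independent of Case 0.1. [folklore] -/
theorem exists_normalized_not_nonDegenerate :
    ∃ C : Semicircuit 3, C.Fair ∧ C.Normalized ∧ (∀ k, IsAndOp (C.op k)) ∧ ¬ C.NonDegenerate := by
  let C : Semicircuit 3 :=
    { m := 3
      op := fun k a b => if k = 1 then (!a && b) else (a && b)
      arg := fun k a =>
        if k = 0 then (if a = 0 then .var 0 else .var 1)
        else if k = 1 then (if a = 0 then .var 0 else .var 2)
        else (if a = 0 then .gate 0 else .gate 1)
      out := .gate 2
      xorPart := ∅
      isXorOp_of_mem := fun j hj => absurd hj (Finset.notMem_empty j)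
      mem_of_arg_eq := fun j hj => absurd hj (Finset.notMem_empty j)
      acyclic := ⟨fun k => k.val, by decide⟩ }
  -- the gate equations of `C`
  have hiff : ∀ (x : Fin 3 → Bool) (w : Fin 3 → Bool),
      C.Consistent x w ↔ w 0 = (x 0 && x 1) ∧ w 1 = (!x 0 && x 2) ∧ w 2 = (w 0 && w 1) := by
    intro x w
    constructor
    · intro h
      exact ⟨h (0 : Fin 3), h (1 : Fin 3), h (2 : Fin 3)⟩
    · rintro ⟨h0, h1, h2⟩ j
      fin_cases j
      · exact h0
      · exact h1
      · exact h2
  -- they have exactly one solution: `C` is fair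
  have hF : C.Fair := by
    intro x
    let w₀ : Fin 3 → Bool := fun k => if k = 0 then (x 0 && x 1)
      else if k = 1 then (!x 0 && x 2) else ((x 0 && x 1) && (!x 0 && x 2))
    have hsol : C.Consistent x w₀ := (hiff x w₀).2 ⟨by simp [w₀], by simp [w₀], by simp [w₀]⟩
    refine ⟨w₀, hsol, fun w hw => ?_⟩
    obtain ⟨h0, h1, h2⟩ := (hiff x w).1 hw
    obtain ⟨h0', h1', h2'⟩ := (hiff x w₀).1 hsol
    have e0 : w 0 = w₀ 0 := h0.trans h0'.symm
    have e1 : w 1 = w₀ 1 := h1.trans h1'.symm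
    have e2 : w 2 = w₀ 2 := by rw [h2, h2', e0, e1]
    funext k
    fin_cases k
    · exact e0
    · exact e1
    · exact e2
  -- the output gate `G₂ = (x₀ ∧ x₁) ∧ (¬x₀ ∧ x₂)` is the constant `0`
  have hconst : ∀ (x : Fin 3 → Bool) (w : Fin 3 → Bool), C.Consistent x w → w 2 = false := by
    intro x w hw
    obtain ⟨h0, h1, h2⟩ := (hiff x w).1 hw
    rw [h2, h0, h1]
    cases x 0 <;> simp
  refine ⟨C, hF, ⟨⟨by decide, by decide, by decide⟩, fun G hG => ?_⟩, by decide, fun h =>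
    h (2 : Fin 3) 0 (C.depOnlyOn_of_const (fun x w hw => hconst x w hw) 0)⟩
  unfold Useless at hG
  revert G
  decide

/-! ### The standing assumptions after Case 4 -/

/-- **The standing assumptions of Li–Yang's case analysis when Case 5 begins** (ECCC TR21-023,
§4.1), for a circuit `C` computing `f|_R` with the empty packing:
* Case 0.1: `C` is normalized (Rules 1–5);
* Case 0.2: the output is reachable from every gate of the acyclic part;
* Case 0.3: every gate depends on both of its inputs (in particular no gate computes a constant);
* Case 0.4 (Lemma 3.12): there is no troubled pair — two distinct adjacent troubled gates —, so
  that every packing is empty ("from now on, the circuit is normalized with an empty packing");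
* Case 1: no protected variable feeds two gates or an ∧-type gate;
* Case 2: no protected `0`-variable ("all protected variables are `1`-variables each feeding an
  ⊕-type gate");
* Case 3: for every variable `x` feeding an ∧-type gate `G`, `fanout(x) + fanout(G) ≤ 3`;
* Case 4: no ∧-type gate fed by two variables one of which is a `1`-variable.
[cite: LiYang2022, §4.1 (Cases 0–4)] -/
structure Standing (R : RdqSource n) : Prop where
  /-- Case 0.1 -/
  normalized : C.Normalized
  /-- Case 0.2 -/
  reachesOut : ∀ G, G ∉ C.xorPart → C.ReachesOut G
  /-- Case 0.3 -/
  nonDegenerate : C.NonDegenerate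
  /-- Case 0.4 -/
  no_troubled_pair : ∀ G₁ G₂, G₁ ≠ G₂ → C.Troubled G₁ → C.Troubled G₂ → ¬ C.Adjacent G₁ G₂
  /-- Case 1, first half: a protected variable does not feed two gates -/
  protected_one_reader : ∀ j, R.Protected j → ∀ (k₁ k₂ : Fin C.m) (a₁ a₂ : Fin 2),
    C.arg k₁ a₁ = .var j → C.arg k₂ a₂ = .var j → k₁ = k₂
  /-- Case 1, second half: a protected variable does not feed an ∧-type gate -/
  protected_not_and : ∀ j, R.Protected j → ∀ (G : Fin C.m) (a : Fin 2), C.arg G a = .var j → ¬ IsAndOp (C.op G)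
  /-- Case 2: no protected `0`-variable -/
  protected_pos : ∀ j, R.Protected j → 1 ≤ C.fanout (.var j)
  /-- Case 3 -/
  and_fanout_le : ∀ (j : Fin n) (G : Fin C.m) (a : Fin 2), C.arg G a = .var j → IsAndOp (C.op G) →
    C.fanout (.var j) + C.fanout (.gate G) ≤ 3
  /-- Case 4 -/
  no_and_one_var : ∀ (G : Fin C.m) (x y : Fin n) (ax ay : Fin 2), ax ≠ ay → C.arg G ax = .var x → C.arg G ay = .var y →
    IsAndOp (C.op G) → C.fanout (.var x) ≠ 1

/-! ### The output is not in the xor-part -/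

variable {C}

/-- **The output of a fair semicircuit computing an affine disperser (dimension `≥ 2d + 1`) is
not a gate of the xor-part**: it would be an affine function of the inputs. [cite: LiYang2022, §2.6 (footnote 5)] -/
theorem out_ne_gate_of_mem_xorPart {f : (Fin n → ZMod 2) → Bool} {R : RdqSource n} {d : ℕ} (hf : IsAffineDisperser f d)
    (hd : 2 * d + 1 ≤ R.dim) (hF : C.Fair) (hC : C.ComputesRestr f R) {k : Fin C.m} (hk : k ∈ C.xorPart) :
    C.out ≠ .gate k := by
  intro hout
  have haff : IsXorAffine (C.nodeFn hF C.out) :=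
    C.nodeFn_xorAffine hF C.isClosed_xorPart (fun k hk => (C.isXorOp_of_mem k hk).isAffineOp)
      (fun k' h => by rw [hout] at h; cases h; exact hk)
  refine hf.not_xorAffine_on_sol R hd haff fun v hv => ?_
  exact (hC.2 v hv _ (C.consistent_sol hF _)).symm

/-- In a pre-normalized fair semicircuit computing an affine disperser, **a useless gate is not
the output** (its reader would be a gate of the acyclic part from which the output is not
reachable, or the output would lie in the xor-part). [cite: LiYang2022, §3.3 (Rule 4), §4.1 (Case 0.2)] -/
theorem out_ne_gate_of_useless {f : (Fin n → ZMod 2) → Bool} {R : RdqSource n} {d : ℕ} (hf : IsAffineDisperser f d)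
    (hd : 2 * d + 1 ≤ R.dim) (hF : C.Fair) (hC : C.ComputesRestr f R) (hN : C.PreNormalized) {G : Fin C.m}
    (hG : C.Useless G) : C.out ≠ .gate G := by
  intro hout
  obtain ⟨h1, Q, aQ, aG, hGQ, hQG, -⟩ := hG
  have hGK : G ∉ C.xorPart := fun hGK => out_ne_gate_of_mem_xorPart hf hd hF hC hGK hout
  have hQK : Q ∉ C.xorPart := fun hQK => hGK (C.mem_of_arg_eq Q hQK aQ G hQG)
  -- the output is reachable from `Q`, but every path from `Q` stays in the acyclic part above `G`
  obtain ⟨ρ, hρ⟩ := C.acyclic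
  obtain ⟨k, hk, hpath⟩ := C.reachesOut_of_preNormalized hN hQK
  rw [hout] at hk
  cases hk
  -- along the path ranks increase, and all gates are acyclic
  have key : ∀ k', Relation.ReflTransGen C.Reads Q k' → k' ∉ C.xorPart ∧ ρ Q ≤ ρ k' := by
    intro k' hp
    induction hp with
    | refl => exact ⟨hQK, le_rfl⟩
    | tail _ hread ih =>
      obtain ⟨a, ha⟩ := hread
      rename_i b c _
      have hcK : c ∉ C.xorPart := fun hcK => ih.1 (C.mem_of_arg_eq c hcK a b ha)
      exact ⟨hcK, ih.2.trans (hρ c hcK a b ha ih.1).le⟩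
  have h1 := (key G hpath).2
  have h2 : ρ G < ρ Q := hρ Q hQK aQ G hQG hGK
  omega

end Semicircuit

/-! ### Cases 5–8 as one named fact -/

/-- **Cases 5–8 of Li–Yang's proof of Theorem 4.1** (ECCC TR21-023, §4.1, pp. 20–40: Case 5 "there
is an ∧-type gate fed by two `2`-variables"; then "no ∧-type gate is directly fed by two
variables. Let `G` be a topologically minimal ∧-type gate fed by `I₁` and `I₂`"; Case 6 "let `x`
be a protected variable"; Case 7 "`I₁ = x` is a `2`-variable and `I₂ = Q` is a `1`-gate"; Case 8
"`Q = I₂` is a gate", with xor-reconstruction), vendored as ONE named fact in the generality in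
which the paper argues: for positive parameters with `α_φ < 1/2`, an affine disperser `f` for
dimension `d`, a fair semicircuit `C` computing `f|_R` with `dim R > 2d + 2`, under the standing
assumptions established by Cases 0–4 (`Semicircuit.Standing`: normalized, output reachable from
the acyclic part, every gate depending on both inputs, no troubled pair — so the packing is
empty —, no configuration of Cases 1–4), the conclusion of the one-step claim `LiYang2022_step`
holds for `(C, ∅, R)`: a simplification without substitution, or `1 ≤ t ≤ 3` substitutions with
`Δμ ≥ δ t`. NAMED FACT, not proved here; with `LiYang2022_step_of_cases5to8` (to follow) it is
the only unproved input to `LiYang2022_step`, hence to `li_yang`.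
[cite: LiYang2022, proof of Thm. 4.1 (§4.1, Cases 5–8)] -/
def LiYang2022_cases5to8 : Prop :=
  ∀ (αφ αI αQ : ℝ), 0 < αφ → αφ < 1 / 2 → 0 < αI → 0 < αQ →
  ∀ (n d : ℕ) (f : (Fin n → ZMod 2) → Bool), IsAffineDisperser f d →
  ∀ (C : Semicircuit n) (R : RdqSource n), C.Fair → C.ComputesRestr f R → 2 * d + 2 < R.dim → C.Standing R →
    (∃ (C' : Semicircuit n) (P' : Finset (Fin C'.m × Fin C'.m)),
        C'.Fair ∧ C'.ComputesRestr f R ∧ C'.IsPacking P' ∧ C'.m < C.m ∧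
          C'.measure αφ αI αQ P' R ≤ C.measure αφ αI αQ ∅ R) ∨
    (∃ t : ℕ, 1 ≤ t ∧ t ≤ 3 ∧
      ∃ (C' : Semicircuit n) (R' : RdqSource n) (P' : Finset (Fin C'.m × Fin C'.m)),
        C'.Fair ∧ C'.ComputesRestr f R' ∧ C'.IsPacking P' ∧ R'.dim + t = R.dim ∧
          liYangDelta αφ αI αQ * t ≤ C.measure αφ αI αQ ∅ R - C'.measure αφ αI αQ P' R')

end Literature.Computability.Complexity
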